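import Summits.BirchSwinnertonDyer.Rank1Residual.P2.TwistInvarianceAtTwoAxes
import Summits.BirchSwinnertonDyer.Rank1Residual.P2.TransportAtTwo
import Summits.BirchSwinnertonDyer.Rank1Residual.P2.RouteTargetsAtTwo
import HarnessLib

/-!
# Cell «bsd-uniform», track U2, route C — the a_q-ODD GENUS-TWIST FAMILY as a CLASS AT `2`
# (P2 currency `ClassAtTwo` / `BSDTwoOn` / the `160`-cell grid), its CELL BOOKKEEPING, the decidable
# RESIDUE predicate on cells, and the class statements in `BSD(E,2)` currency

HONEST FRAMING (cell «bsd-uniform», run/shared/lean/pub/bsd-uniform/, seat u2-p3): the cell's target is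
a CONDUCTOR-FREE, CLASS-LEVEL `BSD(E,2)` statement replacing per-curve certificates. This file defines
the class the «a_q-odd combination at 2» reaches — the GENUS-TWIST FAMILY of a base pair — in the
census's own currency (`Summit.BirchSwinnertonDyer.Rank1Residual.P2.ClassAtTwo`, `TwistFamilyAtTwo`,
`cellAtTwoOf`, p312800/p313052 of the «bsd-p2» typer), proves WHERE on the `160`-cell grid that class
lives (never in a `borel` cell; in the (image, CM) column of its base), and states the class's
`BSD(·,2)` statement as the CONSEQUENCE of a Cor-C-shaped hypothesis (route B's deliverable,
u2-p2) — a RELATIVE uniform statement (transport along the family), ANCHORED on the base pair's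
per-curve inputs ((H-y), `BSD₂(E)`, `BSD₂(E^{(d_K)})`; referee PROTOCOL L6), LITERAL exactly on twist
families of literal bases. It asserts NO arithmetic fact (every input is an explicit binder; the only
named fact used in a proof is Dokchitser–Dokchitser 2012 as typed, for the image axis) and claims NO case
of the Birch–Swinnerton-Dyer conjecture. The residue — what this class does NOT reach — is the decidable
predicate `U2ResidueCell` (§3) plus the non-grid rows of HOME/RESIDUE.md §U2 (R2-1 … R2-11: even
Tamagawa numbers, `h_∞ = 1`, Ш-floor, L1 / analytic dichotomy / composed trace as binders).

## Contents

* §1 `IsGenusPrime W D_K q` (`q ∤ 2N`, `q ∤ D_K`, `a_q(E)` odd), `IsGenusParam W D_K d` (`d ≡ 1 (4)`,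
  `d ≠ 1`, `|d|` square-free on genus primes) — idea-2's `InSPrime` / `InTPrime` (T4PrimeSketch.lean)
  with the Heegner discriminant as a parameter; the class `GenusTwistFamilyAtTwo W D_K` = both members
  `E^{(d)}`, `E^{(d·D_K)}` as a `TwistFamilyAtTwo` (P2 convention `C • E.quadraticTwist e = W′`).
* §2 CELL BOOKKEEPING (theorems): a member of the family of a base with `E(ℚ)[2] = 0` has image bit
  `≠ borel` (`img_ne_borel_of_genusTwistFamily`, from P2's `img_ne_borel_of_twist_of_forall_two_nsmul`);
  its CM bit equals the base's (`cm_eq_of_genusTwistFamily`, unconditional) and so does its image bit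
  granted DD12 (`img_eq_of_genusTwistFamily`); a non-CM base has non-CM members.
* §3 THE RESIDUE ON THE GRID: `U2ResidueCell c := (c.img = borel) ∨ (c.cm ≠ none)` (decidable); members
  of the family of a non-CM base with `E(ℚ)[2] = 0` never lie in a residue cell
  (`u2ResidueCell_cellAtTwoOf_eq_false`); counts by `decide`: `130` residue cells, `30` reached cells
  (`2` rank bits × `5` reduction values × `3` image values × `{none}`) — ALL FIVE reduction types at `2`
  are reached by the rank layer (it has no local input); the `BSD₂` layer's finer residue (even `c₂`,
  i.e. Kodaira `III, III*, I_n^*`, `I_{2k}`; `h_∞ = 1`) is not a grid bit and is carried in RESIDUE.md.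
* §4 CLASS STATEMENTS: `bsdTwoOn_genusTwistFamily_of_corC` — the family's `BSD(·,2)` statement on the
  sub-family `h_∞ = 0` from a Cor-C-shaped hypothesis (route B) quantified over all minimal models;
  `bsdTwoOn_genusTwistFamily_inter_cell` — its per-cell instances.

References: T4-PROOF.md v1.9b §1, §7 (b2b/bsd-rank1-residual/p2/idea-2/); Kriz–Li 2019 Def. 4.1 (the
split-prime neighbour `InS`/`InN`) [KrizLi2019]; Dokchitser–Dokchitser 2012 [DokchitserDokchitserMathZ2012];
Miller 2011 Def. 1.1 [Miller2011LMS]; HOME/PLAN.md §2 U2; HOME/RESIDUE.md §U2.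
-/

noncomputable section

open scoped Classical

open WeierstrassCurve Literature.NumberTheory.EllipticCurves
  Literature.NumberTheory.EllipticCurves.Rank1Residual
  Literature.NumberTheory.EllipticCurves.Rank1Residual.Typed
  Summit.BirchSwinnertonDyer.Rank1Residual.P2

set_option autoImplicit false

namespace Summit.BirchSwinnertonDyer.Uniform.U2

/-! ## §1 The genus-twist parameter set and the class -/

/-- **A genus prime for `(E, D_K)`**: a prime `q` with `q ∤ 2N`, `q ∤ D_K` and `a_q(E)` ODD (Frobenius
of order `3` on `E[2]`); NO splitting condition in `K` (inert and split primes both allowed — the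
complement of Kriz–Li's `InS`, which asks `q` split). Idea-2's `InSPrime` with the Heegner discriminant
as an integer parameter. [folklore] -/
def IsGenusPrime (W : WeierstrassCurve ℚ) [W.IsGloballyMinimal] (DK : ℤ) (q : ℕ) : Prop :=
  q.Prime ∧ ¬ q ∣ 2 * W.conductorNorm ℤ ∧ ¬ (q : ℤ) ∣ DK ∧ Odd (W.frobeniusTrace q)

/-- **A genus parameter `d ∈ 𝒯′(E, K)`**: `d ≡ 1 (mod 4)`, `d ≠ 1`, `|d|` a square-free product of
genus primes (`d = M*` of T4-PROOF §1). [folklore] -/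
def IsGenusParam (W : WeierstrassCurve ℚ) [W.IsGloballyMinimal] (DK : ℤ) (d : ℤ) : Prop :=
  d % 4 = 1 ∧ d ≠ 1 ∧ Squarefree d.natAbs ∧ ∀ q : ℕ, q.Prime → q ∣ d.natAbs → IsGenusPrime W DK q

/-- **The genus-twist family of the base pair `(E, E^{(D_K)})` as a class at `2`**: globally minimal
models of `E^{(d)}` and of `E^{(d·D_K)}` for genus parameters `d` — P2's `TwistFamilyAtTwo` with the
parameter set `{d, d·D_K : d ∈ 𝒯′}` (convention `C • E.quadraticTwist e = W′`). [folklore] -/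
def GenusTwistFamilyAtTwo (W : WeierstrassCurve ℚ) [W.IsGloballyMinimal] (DK : ℤ) : ClassAtTwo :=
  TwistFamilyAtTwo W fun e : ℚ => ∃ d : ℤ, IsGenusParam W DK d ∧ ((e = d) ∨ (e = d * DK))

/-- The sub-family with the sign condition `h_∞ = 0` (`d > 0 ∨ Δ_E < 0`; Zhai 2016's `M > 0 or Δ < 0`),
the part of the family Cor C reaches at the `BSD₂` level. [folklore] -/
def GenusTwistFamilyAtTwoPos (W : WeierstrassCurve ℚ) [W.IsGloballyMinimal] (DK : ℤ) : ClassAtTwo :=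
  TwistFamilyAtTwo W fun e : ℚ =>
    ∃ d : ℤ, IsGenusParam W DK d ∧ (0 < d ∨ W.Δ < 0) ∧ ((e = d) ∨ (e = d * DK))

section Params

variable {W : WeierstrassCurve ℚ} [W.IsGloballyMinimal] {DK d : ℤ}

/-- A genus parameter is odd (hence nonzero): `d ≡ 1 (mod 4)`. [folklore] -/
theorem IsGenusParam.odd (h : IsGenusParam W DK d) : Odd d := by
  rcases h with ⟨h4, -⟩
  refine Int.odd_iff.mpr ?_
  omega

/-- A genus parameter is nonzero. [folklore] -/
theorem IsGenusParam.ne_zero (h : IsGenusParam W DK d) : d ≠ 0 := by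
  rintro rfl
  exact absurd h.odd (by decide)

/-- The rational twisting parameter of a member is nonzero when `D_K ≠ 0`. [folklore] -/
theorem ne_zero_of_genus_member (hDK : DK ≠ 0) {e : ℚ}
    (he : ∃ d : ℤ, IsGenusParam W DK d ∧ ((e = d) ∨ (e = d * DK))) : e ≠ 0 := by
  obtain ⟨d, hd, rfl | rfl⟩ := he
  · exact_mod_cast hd.ne_zero
  · exact_mod_cast mul_ne_zero hd.ne_zero hDK

/-- The `h_∞ = 0` sub-family is contained in the family. [folklore] -/
theorem genusTwistFamilyAtTwoPos_le (W' : WeierstrassCurve ℚ) [W'.IsElliptic] [W'.IsGloballyMinimal]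
    (h : GenusTwistFamilyAtTwoPos W DK W') : GenusTwistFamilyAtTwo W DK W' :=
  twistFamilyAtTwo_mono W (fun _ ⟨d, hd, _, he⟩ => ⟨d, hd, he⟩) W' h

end Params

/-! ## §2 Cell bookkeeping: where the family lives on the `160`-cell grid -/

section Cells

variable (W : WeierstrassCurve ℚ) [W.IsElliptic] [W.IsGloballyMinimal] {DK : ℤ}
  {W' : WeierstrassCurve ℚ} [W'.IsElliptic] [W'.IsGloballyMinimal]

/-- **Members of the genus-twist family of a base with `E(ℚ)[2] = 0` are never in a `borel` cell**
(image bit `surj8`, `surjNot8` or `cyclic3`): the `2`-division field is twist-invariant. Residue row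
R2-2 read positively. [cite: SilvermanAEC2009, X.5 Cor. 5.4] -/
theorem img_ne_borel_of_genusTwistFamily (h2 : ∀ Q : W.toAffine.Point, 2 • Q = 0 → Q = 0)
    (hDK : DK ≠ 0) (hW' : GenusTwistFamilyAtTwo W DK W') : (cellAtTwoOf W').img ≠ .borel := by
  obtain ⟨e, he, hC⟩ := hW'
  exact img_ne_borel_of_twist_of_forall_two_nsmul W h2 (ne_zero_of_genus_member hDK he) hC

/-- **The CM bit is constant along the family** (unconditionally). [cite: SilvermanAEC2009, App. C §11] -/
theorem cm_eq_of_genusTwistFamily (hDK : DK ≠ 0) (hW' : GenusTwistFamilyAtTwo W DK W') :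
    (cellAtTwoOf W').cm = (cellAtTwoOf W).cm := by
  obtain ⟨e, he, hC⟩ := hW'
  exact cellAtTwoOf_cm_eq_of_twist W (ne_zero_of_genus_member hDK he) hC

/-- **The image bit is constant along the family**, granted Dokchitser–Dokchitser 2012 as typed.
[cite: DokchitserDokchitserMathZ2012, Theorem (p. 961)] -/
theorem img_eq_of_genusTwistFamily (hDD : DokchitserDokchitser2012_surjective_mod_two_four_eight)
    (hDK : DK ≠ 0) (hW' : GenusTwistFamilyAtTwo W DK W') :
    (cellAtTwoOf W').img = (cellAtTwoOf W).img := by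
  obtain ⟨e, he, hC⟩ := hW'
  exact (cellAtTwoOf_img_cm_eq_of_twist W hDD (ne_zero_of_genus_member hDK he) hC).1

/-- A non-CM base has a non-CM family (the O1 / O12 boundary is not crossed).
[cite: SilvermanAEC2009, App. C §11] -/
theorem not_hasCM_of_genusTwistFamily (hcm : ¬ W.HasCM) (hDK : DK ≠ 0)
    (hW' : GenusTwistFamilyAtTwo W DK W') : ¬ W'.HasCM := by
  obtain ⟨e, he, hC⟩ := hW'
  exact not_hasCM_of_twist W hcm (ne_zero_of_genus_member hDK he) hC

end Cells

/-! ## §3 The residue on the grid (decidable) -/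

/-- **The U2 residue predicate on cells**: a cell is OUTSIDE the reach of the a_q-odd genus-twist line
iff its image bit is `borel` (a rational `2`-torsion point: L1 fails — RESIDUE R2-2; the a_q-even
engines CLTZ 2015 / Cai–Li–Zhai 2020 / Shu–Zhai 2021 live there) or its CM bit is not `none` (pocket
O12, outside U2 by PLAN §2 — RESIDUE R2-6). Every other cell — ALL five reduction types at `2`, both
rank bits — is reached by the rank layer, which has no local input. [folklore] -/
def U2ResidueCell (c : CellAtTwo) : Bool :=
  decide (c.img = .borel) || !decide (c.cm = .none)

/-- **Members of the genus-twist family of a non-CM base with `E(ℚ)[2] = 0` never lie in a residue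
cell.** [cite: SilvermanAEC2009, X.5 Cor. 5.4 and App. C §11] -/
theorem u2ResidueCell_cellAtTwoOf_eq_false (W : WeierstrassCurve ℚ) [W.IsElliptic] [W.IsGloballyMinimal]
    {DK : ℤ} (h2 : ∀ Q : W.toAffine.Point, 2 • Q = 0 → Q = 0) (hcm : ¬ W.HasCM) (hDK : DK ≠ 0)
    {W' : WeierstrassCurve ℚ} [W'.IsElliptic] [W'.IsGloballyMinimal]
    (hW' : GenusTwistFamilyAtTwo W DK W') : U2ResidueCell (cellAtTwoOf W') = false := by
  have himg := img_ne_borel_of_genusTwistFamily W h2 hDK hW'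
  have hcm' : (cellAtTwoOf W').cm = .none :=
    (cellAtTwoOf_cm_eq_none_iff W').mpr (not_hasCM_of_genusTwistFamily W hcm hDK hW')
  simp [U2ResidueCell, himg, hcm']

/-- **COUNTS.** Of the `160` cells, `130` are residue cells and `30` are reached
(`2` rank bits × `5` reduction values × `3` image values × CM `none`); all `30` reached cells are
consistent cells of status `openO1 _` (the open non-CM register at `2`). [folklore] -/
theorem u2ResidueCell_counts :
    (CellAtTwo.all.filter fun c => U2ResidueCell c = true).length = 130 ∧
      (CellAtTwo.all.filter fun c => U2ResidueCell c = false).length = 30 ∧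
      (∀ c : CellAtTwo, U2ResidueCell c = false → c.status = .openO1 c.red) := by
  refine ⟨by decide +kernel, by decide +kernel, by decide +kernel⟩

/-- Every reduction type at `2` is reached: for each of the five reduction values and each rank bit
there is a reached cell (the rank layer has no local hypothesis at `2`). [folklore] -/
theorem exists_reached_cell (r1 : Bool) (s : RedTwo) :
    ∃ c : CellAtTwo, c.r1 = r1 ∧ c.red = s ∧ U2ResidueCell c = false :=
  ⟨⟨r1, s, .surj8, .none⟩, rfl, rfl, by cases r1 <;> cases s <;> decide⟩

/-! ## §4 The class statements in `BSD(E,2)` currency -/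

/-- **THE FAMILY'S `BSD(·,2)` STATEMENT FROM A COR-C-SHAPED HYPOTHESIS** (route B's deliverable, taken
as the binder `hcorC`: for every genus parameter `d` with `h_∞ = 0` and every globally minimal models
`W₁` of `E^{(d)}` and `W₂` of `E^{(d·D_K)}`, both have analytic rank `≤ 1` and `BSD(·,2)`). Then the
class `GenusTwistFamilyAtTwoPos W D_K` has its BSD-at-2 statement (P2 currency `BSDTwoOn`) — the
hypothesis is quantified over ALL globally minimal models of each member, so no transport along
`ℚ`-isomorphisms is needed here (P2's `bsdp_two_of_smul_eq` does it inside route B). CONDITIONAL on the base pair's inputs hidden in `hcorC` ((H-y),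
`BSD₂(E)`, `BSD₂(E^{(D_K)})`, `Ш[2] = 0`) — a RELATIVE uniform statement; it books no conversion by
itself (referee PROTOCOL L6). [cite: Miller2011LMS, Def. 1.1] -/
theorem bsdTwoOn_genusTwistFamily_of_corC (W : WeierstrassCurve ℚ) [W.IsElliptic] [W.IsGloballyMinimal]
    (DK : ℤ)
    (hcorC : ∀ d : ℤ, IsGenusParam W DK d → (0 < d ∨ W.Δ < 0) →
      ∀ (W₁ : WeierstrassCurve ℚ) [W₁.IsElliptic] [W₁.IsGloballyMinimal],
        ((∃ C : VariableChange ℚ, C • W.quadraticTwist (d : ℚ) = W₁) ∨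
          (∃ C : VariableChange ℚ, C • W.quadraticTwist ((d * DK : ℤ) : ℚ) = W₁)) →
        W₁.analyticRank ≤ 1 ∧ BSDp W₁ 2) :
    BSDTwoOn (GenusTwistFamilyAtTwoPos W DK) := by
  intro W' _ _ _ hW'
  obtain ⟨e, ⟨d, hd, hsgn, he⟩, C, hC⟩ := hW'
  have key := hcorC d hd hsgn W'
  rcases he with rfl | rfl
  · exact (key (Or.inl ⟨C, hC⟩)).2
  · have hC' : C • W.quadraticTwist ((d * DK : ℤ) : ℚ) = W' := by push_cast; exact hC
    exact (key (Or.inr ⟨C, hC'⟩)).2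

/-- The same statement restricted to any cell: `BSDTwoOn (family ∩ cell c)` — the per-cell rows of the
CONVERSIONS table are instances of the family statement (antitonicity of `BSDTwoOn`). [cite: Miller2011LMS, Def. 1.1] -/
theorem bsdTwoOn_genusTwistFamily_inter_cell (W : WeierstrassCurve ℚ) [W.IsElliptic]
    [W.IsGloballyMinimal] (DK : ℤ) (c : CellAtTwo) (h : BSDTwoOn (GenusTwistFamilyAtTwoPos W DK)) :
    BSDTwoOn fun W' _ _ => GenusTwistFamilyAtTwoPos W DK W' ∧ c.HoldsAt W' :=
  bsdTwoOn_mono (fun _ _ _ hW' => hW'.1) h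

end Summit.BirchSwinnertonDyer.Uniform.U2

end
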